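import Literature.Analysis.SpecialFunctions.LogOnePlusSqIntegral
import Mathlib.MeasureTheory.Measure.Haar.NormedSpace
import Mathlib.Analysis.SpecialFunctions.ImproperIntegrals
import HarnessLib

/-!
# The error integral of Ford's Lemma 4.5: `∫ (4.62 + ½ log(1 + v²/9))/(c² + (t − v)²) dv`

Topic `Literature/NumberTheory/LFunctions`, family RH (explicit zero-free regions). Everything in
this file is PROVED; no named fact, no definition.

In K. Ford, *Zero-free regions for the Riemann zeta function* (2002), Lemma 4.5, the contour of
`(1/2πi)∫ (−ζ'/ζ)(w) F₀(s − w) dw` is moved to `Re w = −1/2`, where `|ζ'/ζ(−½ + iv)| ≤ 4.62 + ½ log(1 + v²/9)`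
(Lemma 3.2, the tree's `FordL32.norm_logDeriv_zeta_left_le`) and `|F₀(s − w)| ≤ D/|s − w|²`,
`|s − w|² = (σ + ½)² + (t − v)²`. The resulting error is `(D/2π) I'`,
`I' = ∫ (4.62 + ½ log(1 + v²/9))/((σ + ½)² + (t − v)²) dv`. This file bounds `I'`:

* `FordL45.error_integral_le` — for `c ≥ 3/2` and real `t`:
  `∫ (4.62 + ½ log(1 + v²/9))/(c² + (t − v)²) dv ≤ 2π·(4.62/3) + ⅓(π log(1 + t²) + 2π log 2)`;
* `FordL45.error_integral_zero_le` — for `c ≥ 3/2`, `t = 0` (the case `s = σ` real of the bound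
  `K(1) ≤ F(0) + 1.8D`): `… ≤ 2π·(4.62/3) + ⅓(2π log 2 − 3π/8)`;
* the ingredients `integral_inv_sq_add_sq` (`∫ dv/(c² + (t−v)²) = π/c`), `integral_log_div_le`,
  `integral_log_div_zero_le` (the substitution `v = t + 3x/2`, the inequality
  `1 + (t/3 + x/2)² ≤ (1 + t²)(1 + x²)`, and `∫ log(1+x²)/(1+x²) = 2π log 2`,
  `∫ log(1 + x²/4)/(1+x²) ≤ 2π log 2 − 3π/8` from
  `Literature/Analysis/SpecialFunctions/LogOnePlusSqIntegral.lean`).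

Faithfulness note. Ford writes `I' ≤ 3.08π + ⅓∫[log(1+t²) + log(1+v²)]/(1+v²) dv ≤ 10.8 + (2π/3) log(1+t)`;
the middle expression equals `3.08π + ⅓π log(1+t²) + (2π/3) log 2 = 11.128… + ⅓π log(1+t²)`, so the
printed `10.8` is a slip for `11.13`, and the constant of Lemma 4.5 is `(11.13)/(2π) = 1.771`, not
`1.72`. Lemma 4.6 (`1.8`) is unaffected: `1.771 + 1/t² + 1/(3t) < 1.8` for `t ≥ 1000`, and on the
real axis the sharper `error_integral_zero_le` gives `1.709`, so `K(1) ≤ F(0) + (1.709 + 0.0463)D`.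

## References

* K. Ford, *Zero-free regions for the Riemann zeta function*, Number Theory for the Millennium II
  (Urbana 2000), A K Peters 2002, 25–56 (arXiv:1910.08205), proof of Lemma 4.5.
  [Ford2002Millennium]
-/

noncomputable section

open Real Set MeasureTheory

namespace Literature.NumberTheory.LFunctions

namespace FordL45

open Literature.Analysis.SpecialFunctions

/-! ### Elementary integrals -/

/-- `∫ dv/(c² + (t − v)²) = π/c` (`c > 0`). [folklore] -/
theorem integral_inv_sq_add_sq {c : ℝ} (hc : 0 < c) (t : ℝ) :
    ∫ v : ℝ, 1 / (c ^ 2 + (t - v) ^ 2) = π / c := by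
  have h1 : (fun v : ℝ ↦ 1 / (c ^ 2 + (t - v) ^ 2)) = fun v ↦ (fun u : ℝ ↦ 1 / (c ^ 2 + u ^ 2)) (v - t) := by
    funext v; simp only; ring_nf
  rw [h1, integral_sub_right_eq_self (fun u : ℝ ↦ 1 / (c ^ 2 + u ^ 2)) t]
  have h2 : (fun u : ℝ ↦ 1 / (c ^ 2 + u ^ 2)) = fun u ↦ (fun x : ℝ ↦ 1 / c ^ 2 * (1 + x ^ 2)⁻¹) (c⁻¹ * u) := by
    funext u; simp only; field_simp
  rw [h2, Measure.integral_comp_inv_mul_left (fun x : ℝ ↦ 1 / c ^ 2 * (1 + x ^ 2)⁻¹) c,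
    MeasureTheory.integral_const_mul, integral_univ_inv_one_add_sq, abs_of_pos hc, smul_eq_mul]
  field_simp

/-- `v ↦ 1/(c² + (t − v)²)` is integrable (`c > 0`). [folklore] -/
theorem integrable_inv_sq_add_sq {c : ℝ} (hc : 0 < c) (t : ℝ) :
    Integrable fun v : ℝ ↦ 1 / (c ^ 2 + (t - v) ^ 2) := by
  have h := (integrable_inv_one_add_sq.comp_mul_left' (inv_ne_zero hc.ne')).comp_sub_right t
  refine ((h.const_mul (1 / c ^ 2)).congr (ae_of_all _ fun v ↦ ?_))
  field_simp
  ring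

/-- `1 + (a + b)² ≤ (1 + 9a²)(1 + 4b²)` (AM–GM: `2ab ≤ 8a² + 3b²`). [folklore] -/
theorem one_add_sq_add_le (a b : ℝ) : 1 + (a + b) ^ 2 ≤ (1 + 9 * a ^ 2) * (1 + 4 * b ^ 2) := by
  nlinarith [sq_nonneg (2 * a - b), sq_nonneg (a * b), sq_nonneg a, sq_nonneg b]

/-- `v ↦ log(1 + v²/9)/(9/4 + (t − v)²)` is integrable (dominated by
`log(1 + t²)/(9/4 + (t−v)²) + log(1 + (t−v)²)/(1 + (t−v)²)`, as `1 + v²/9 ≤ (1 + t²)(1 + (t−v)²)`).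
[folklore] -/
theorem integrable_log_div (t : ℝ) :
    Integrable fun v : ℝ ↦ Real.log (1 + v ^ 2 / 9) / (9 / 4 + (t - v) ^ 2) := by
  have hI1 : Integrable fun v : ℝ ↦ 1 / ((3 / 2 : ℝ) ^ 2 + (t - v) ^ 2) :=
    integrable_inv_sq_add_sq (by norm_num) t
  have hI2 : Integrable fun v : ℝ ↦ Real.log (1 + (v - t) ^ 2) / (1 + (v - t) ^ 2) :=
    integrable_log_one_add_sq_div.comp_sub_right t
  have hb := (hI1.const_mul (Real.log (1 + t ^ 2))).add hI2
  refine hb.mono ?_ (ae_of_all _ fun v ↦ ?_)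
  · exact ((Continuous.log (by fun_prop) (fun v ↦ by positivity)).div (by fun_prop)
      (fun v ↦ by positivity)).aestronglyMeasurable
  · have hv9 : 0 ≤ Real.log (1 + v ^ 2 / 9) := Real.log_nonneg (by nlinarith)
    have ht2 : 0 ≤ Real.log (1 + t ^ 2) := Real.log_nonneg (by nlinarith)
    have hw2 : 0 ≤ Real.log (1 + (v - t) ^ 2) := Real.log_nonneg (by nlinarith)
    have hden : 0 < 9 / 4 + (t - v) ^ 2 := by positivity
    have hden' : 0 < 1 + (v - t) ^ 2 := by positivity
    rw [Real.norm_eq_abs, abs_of_nonneg (div_nonneg hv9 hden.le), Real.norm_eq_abs]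
    refine le_trans ?_ (le_abs_self _)
    simp only [Pi.add_apply]
    have hsplit : Real.log (1 + v ^ 2 / 9) ≤ Real.log (1 + t ^ 2) + Real.log (1 + (v - t) ^ 2) := by
      rw [← Real.log_mul (by positivity) (by positivity)]
      refine Real.log_le_log (by positivity) ?_
      nlinarith [sq_nonneg (t - v), sq_nonneg (2 * t - v), sq_nonneg v, sq_nonneg t,
        mul_nonneg (sq_nonneg t) (sq_nonneg (v - t))]
    have e94 : (3 / 2 : ℝ) ^ 2 + (t - v) ^ 2 = 9 / 4 + (t - v) ^ 2 := by norm_num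
    rw [e94]
    have h1 : Real.log (1 + v ^ 2 / 9) / (9 / 4 + (t - v) ^ 2) ≤
        (Real.log (1 + t ^ 2) + Real.log (1 + (v - t) ^ 2)) / (9 / 4 + (t - v) ^ 2) :=
      div_le_div_of_nonneg_right hsplit hden.le
    have h2 : Real.log (1 + (v - t) ^ 2) / (9 / 4 + (t - v) ^ 2) ≤
        Real.log (1 + (v - t) ^ 2) / (1 + (v - t) ^ 2) :=
      div_le_div_of_nonneg_left hw2 hden' (by nlinarith)
    rw [add_div] at h1
    have e : Real.log (1 + t ^ 2) * (1 / (9 / 4 + (t - v) ^ 2)) = Real.log (1 + t ^ 2) / (9 / 4 + (t - v) ^ 2) := by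
      ring
    rw [e]
    linarith

/-- The logarithmic part, general `t`:
`∫ log(1 + v²/9)/(9/4 + (t − v)²) dv ≤ (2/3)(π log(1 + t²) + 2π log 2)`
(`v = t + 3x/2`; `log(1 + (t/3 + x/2)²) ≤ log(1 + t²) + log(1 + x²)`, `one_add_sq_add_le`).
[cite: Ford2002Millennium, Lemma 4.5 (proof)] -/
theorem integral_log_div_le (t : ℝ) :
    ∫ v : ℝ, Real.log (1 + v ^ 2 / 9) / (9 / 4 + (t - v) ^ 2) ≤
      2 / 3 * (π * Real.log (1 + t ^ 2) + 2 * π * Real.log 2) := by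
  set g : ℝ → ℝ := fun x ↦ 2 / 3 * (Real.log (1 + (t / 3 + x / 2) ^ 2) / (1 + x ^ 2)) with hg
  have hsub : ∫ v : ℝ, Real.log (1 + v ^ 2 / 9) / (9 / 4 + (t - v) ^ 2) = ∫ x : ℝ, g x := by
    have h1 : (fun v : ℝ ↦ Real.log (1 + v ^ 2 / 9) / (9 / 4 + (t - v) ^ 2)) =
        fun v ↦ (fun u : ℝ ↦ Real.log (1 + (t + u) ^ 2 / 9) / (9 / 4 + u ^ 2)) (v - t) := by
      funext v; simp only; ring_nf
    rw [h1, integral_sub_right_eq_self (fun u : ℝ ↦ Real.log (1 + (t + u) ^ 2 / 9) / (9 / 4 + u ^ 2)) t]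
    have h2 : (fun u : ℝ ↦ Real.log (1 + (t + u) ^ 2 / 9) / (9 / 4 + u ^ 2)) =
        fun u ↦ (fun x : ℝ ↦ 2 / 3 * g x) ((3 / 2 : ℝ)⁻¹ * u) := by
      funext u; simp only [hg]
      have e1 : 1 + (t + u) ^ 2 / 9 = 1 + (t / 3 + (3 / 2 : ℝ)⁻¹ * u / 2) ^ 2 := by ring
      have e2 : 9 / 4 + u ^ 2 = 9 / 4 * (1 + ((3 / 2 : ℝ)⁻¹ * u) ^ 2) := by ring
      rw [e1, e2]; field_simp; ring
    rw [h2, Measure.integral_comp_inv_mul_left (fun x : ℝ ↦ 2 / 3 * g x), MeasureTheory.integral_const_mul,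
      abs_of_pos (by norm_num : (0 : ℝ) < 3 / 2), smul_eq_mul]
    ring
  rw [hsub]
  have hI := integrable_log_one_add_sq_div
  have h1I : Integrable fun x : ℝ ↦ Real.log (1 + t ^ 2) * (1 + x ^ 2)⁻¹ :=
    integrable_inv_one_add_sq.const_mul _
  have hmajor : Integrable fun x : ℝ ↦ 2 / 3 * ((Real.log (1 + t ^ 2) + Real.log (1 + x ^ 2)) / (1 + x ^ 2)) := by
    refine ((h1I.add hI).const_mul (2 / 3)).congr (ae_of_all _ fun x ↦ ?_)
    simp only [Pi.add_apply]
    field_simp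
  have hle : ∀ x : ℝ, g x ≤ 2 / 3 * ((Real.log (1 + t ^ 2) + Real.log (1 + x ^ 2)) / (1 + x ^ 2)) := by
    intro x
    simp only [hg]
    refine mul_le_mul_of_nonneg_left (div_le_div_of_nonneg_right ?_ (by positivity)) (by norm_num)
    rw [← Real.log_mul (by positivity) (by positivity)]
    refine Real.log_le_log (by positivity) ?_
    have := one_add_sq_add_le (t / 3) (x / 2)
    nlinarith
  by_cases hgi : Integrable g
  · calc ∫ x, g x ≤ ∫ x : ℝ, 2 / 3 * ((Real.log (1 + t ^ 2) + Real.log (1 + x ^ 2)) / (1 + x ^ 2)) :=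
          integral_mono hgi hmajor hle
      _ = 2 / 3 * (π * Real.log (1 + t ^ 2) + 2 * π * Real.log 2) := by
          rw [MeasureTheory.integral_const_mul]
          congr 1
          have e : (fun x : ℝ ↦ (Real.log (1 + t ^ 2) + Real.log (1 + x ^ 2)) / (1 + x ^ 2)) =
              fun x ↦ Real.log (1 + t ^ 2) * (1 + x ^ 2)⁻¹ + Real.log (1 + x ^ 2) / (1 + x ^ 2) := by
            funext x; field_simp
          rw [e, integral_add h1I hI, MeasureTheory.integral_const_mul, integral_univ_inv_one_add_sq,
            integral_log_one_add_sq_div]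
          ring
  · rw [integral_undef hgi]
    have h2 := Real.log_two_gt_d9
    have : 0 ≤ Real.log (1 + t ^ 2) := Real.log_nonneg (by nlinarith)
    nlinarith [Real.pi_gt_three]

/-- The logarithmic part at `t = 0`:
`∫ log(1 + v²/9)/(9/4 + v²) dv ≤ (2/3)(2π log 2 − 3π/8)` (`v = 3x/2`).
[cite: Ford2002Millennium, Lemma 4.5 (proof)] -/
theorem integral_log_div_zero_le :
    ∫ v : ℝ, Real.log (1 + v ^ 2 / 9) / (9 / 4 + v ^ 2) ≤ 2 / 3 * (2 * π * Real.log 2 - 3 * π / 8) := by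
  have h2 : (fun u : ℝ ↦ Real.log (1 + u ^ 2 / 9) / (9 / 4 + u ^ 2)) =
      fun u ↦ (fun x : ℝ ↦ 4 / 9 * (Real.log (1 + x ^ 2 / 4) / (1 + x ^ 2))) ((3 / 2 : ℝ)⁻¹ * u) := by
    funext u; simp only
    have e1 : 1 + u ^ 2 / 9 = 1 + ((3 / 2 : ℝ)⁻¹ * u) ^ 2 / 4 := by ring
    have e2 : 9 / 4 + u ^ 2 = 9 / 4 * (1 + ((3 / 2 : ℝ)⁻¹ * u) ^ 2) := by ring
    rw [e1, e2]; field_simp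
  rw [h2, Measure.integral_comp_inv_mul_left (fun x : ℝ ↦ 4 / 9 * (Real.log (1 + x ^ 2 / 4) / (1 + x ^ 2))),
    MeasureTheory.integral_const_mul, abs_of_pos (by norm_num : (0 : ℝ) < 3 / 2), smul_eq_mul]
  have := integral_log_one_add_sq_div_four_le
  nlinarith

/-! ### The error integral -/

/-- **The error integral of Ford's Lemma 4.5, general height.** For `c ≥ 3/2` and real `t`:
`∫ (4.62 + ½ log(1 + v²/9))/(c² + (t − v)²) dv ≤ 2π(4.62/3) + ⅓(π log(1 + t²) + 2π log 2)`.
(Ford: "`I' ≤ 3.08π + ⅓∫ [log(1+t²) + log(1+v²)]/(1+v²) dv`"; the right-hand side equals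
`3.08π + ⅓π log(1+t²) + (2π/3) log 2 = 11.13… + (2π/3) log(1+t)·…`, not the printed `10.8 + …`:
a small slip in the source, immaterial for Ford's Lemma 4.6.) [cite: Ford2002Millennium, Lemma 4.5 (proof)] -/
theorem error_integral_le {c : ℝ} (hc : 3 / 2 ≤ c) (t : ℝ) :
    ∫ v : ℝ, (4.62 + 1 / 2 * Real.log (1 + v ^ 2 / 9)) / (c ^ 2 + (t - v) ^ 2) ≤
      2 * π * (4.62 / 3) + 1 / 3 * (π * Real.log (1 + t ^ 2) + 2 * π * Real.log 2) := by
  have hI1 : Integrable fun v : ℝ ↦ 1 / ((3 / 2 : ℝ) ^ 2 + (t - v) ^ 2) :=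
    integrable_inv_sq_add_sq (by norm_num) t
  have hI2 := integrable_log_div t
  have hψ : Integrable fun v : ℝ ↦ 4.62 * (1 / ((3 / 2 : ℝ) ^ 2 + (t - v) ^ 2)) +
      1 / 2 * (Real.log (1 + v ^ 2 / 9) / (9 / 4 + (t - v) ^ 2)) := (hI1.const_mul _).add (hI2.const_mul _)
  have hle : ∀ v : ℝ, (4.62 + 1 / 2 * Real.log (1 + v ^ 2 / 9)) / (c ^ 2 + (t - v) ^ 2) ≤
      4.62 * (1 / ((3 / 2 : ℝ) ^ 2 + (t - v) ^ 2)) + 1 / 2 * (Real.log (1 + v ^ 2 / 9) / (9 / 4 + (t - v) ^ 2)) := by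
    intro v
    have hv9 : 0 ≤ Real.log (1 + v ^ 2 / 9) := Real.log_nonneg (by nlinarith)
    have hnum : 0 ≤ 4.62 + 1 / 2 * Real.log (1 + v ^ 2 / 9) := by positivity
    have hden : 0 < 9 / 4 + (t - v) ^ 2 := by positivity
    have hc2 : 9 / 4 + (t - v) ^ 2 ≤ c ^ 2 + (t - v) ^ 2 := by nlinarith
    calc (4.62 + 1 / 2 * Real.log (1 + v ^ 2 / 9)) / (c ^ 2 + (t - v) ^ 2)
        ≤ (4.62 + 1 / 2 * Real.log (1 + v ^ 2 / 9)) / (9 / 4 + (t - v) ^ 2) :=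
          div_le_div_of_nonneg_left hnum hden hc2
      _ = _ := by norm_num; ring
  have hRHS : ∫ v : ℝ, (4.62 * (1 / ((3 / 2 : ℝ) ^ 2 + (t - v) ^ 2)) +
      1 / 2 * (Real.log (1 + v ^ 2 / 9) / (9 / 4 + (t - v) ^ 2))) ≤
      2 * π * (4.62 / 3) + 1 / 3 * (π * Real.log (1 + t ^ 2) + 2 * π * Real.log 2) := by
    rw [integral_add (hI1.const_mul _) (hI2.const_mul _), MeasureTheory.integral_const_mul,
      MeasureTheory.integral_const_mul, integral_inv_sq_add_sq (by norm_num : (0 : ℝ) < 3 / 2)]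
    have := integral_log_div_le t
    nlinarith [Real.pi_pos]
  by_cases hφ : Integrable fun v : ℝ ↦ (4.62 + 1 / 2 * Real.log (1 + v ^ 2 / 9)) / (c ^ 2 + (t - v) ^ 2)
  · exact (integral_mono hφ hψ hle).trans hRHS
  · rw [integral_undef hφ]
    have h2 := Real.log_two_gt_d9
    have : 0 ≤ Real.log (1 + t ^ 2) := Real.log_nonneg (by nlinarith)
    nlinarith [Real.pi_gt_three]

/-- **The error integral of Ford's Lemma 4.5 on the real axis** (`t = 0`, the case of `K(σ)`):
for `c ≥ 3/2`, `∫ (4.62 + ½ log(1 + v²/9))/(c² + v²) dv ≤ 2π(4.62/3) + ⅓(2π log 2 − 3π/8)`.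
[cite: Ford2002Millennium, Lemma 4.5 (proof) and Lemma 4.6 (proof, `K(1)`)] -/
theorem error_integral_zero_le {c : ℝ} (hc : 3 / 2 ≤ c) :
    ∫ v : ℝ, (4.62 + 1 / 2 * Real.log (1 + v ^ 2 / 9)) / (c ^ 2 + v ^ 2) ≤
      2 * π * (4.62 / 3) + 1 / 3 * (2 * π * Real.log 2 - 3 * π / 8) := by
  have hI1 : Integrable fun v : ℝ ↦ 1 / ((3 / 2 : ℝ) ^ 2 + (0 - v) ^ 2) :=
    integrable_inv_sq_add_sq (by norm_num) 0
  have hI2 := integrable_log_div 0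
  simp only [zero_sub, even_two, Even.neg_pow] at hI1 hI2
  have hψ : Integrable fun v : ℝ ↦ 4.62 * (1 / ((3 / 2 : ℝ) ^ 2 + v ^ 2)) +
      1 / 2 * (Real.log (1 + v ^ 2 / 9) / (9 / 4 + v ^ 2)) := (hI1.const_mul _).add (hI2.const_mul _)
  have hle : ∀ v : ℝ, (4.62 + 1 / 2 * Real.log (1 + v ^ 2 / 9)) / (c ^ 2 + v ^ 2) ≤
      4.62 * (1 / ((3 / 2 : ℝ) ^ 2 + v ^ 2)) + 1 / 2 * (Real.log (1 + v ^ 2 / 9) / (9 / 4 + v ^ 2)) := by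
    intro v
    have hv9 : 0 ≤ Real.log (1 + v ^ 2 / 9) := Real.log_nonneg (by nlinarith)
    have hnum : 0 ≤ 4.62 + 1 / 2 * Real.log (1 + v ^ 2 / 9) := by positivity
    have hden : 0 < 9 / 4 + v ^ 2 := by positivity
    have hc2 : 9 / 4 + v ^ 2 ≤ c ^ 2 + v ^ 2 := by nlinarith
    calc (4.62 + 1 / 2 * Real.log (1 + v ^ 2 / 9)) / (c ^ 2 + v ^ 2)
        ≤ (4.62 + 1 / 2 * Real.log (1 + v ^ 2 / 9)) / (9 / 4 + v ^ 2) :=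
          div_le_div_of_nonneg_left hnum hden hc2
      _ = _ := by norm_num; ring
  have hRHS : ∫ v : ℝ, (4.62 * (1 / ((3 / 2 : ℝ) ^ 2 + v ^ 2)) +
      1 / 2 * (Real.log (1 + v ^ 2 / 9) / (9 / 4 + v ^ 2))) ≤
      2 * π * (4.62 / 3) + 1 / 3 * (2 * π * Real.log 2 - 3 * π / 8) := by
    rw [integral_add (hI1.const_mul _) (hI2.const_mul _), MeasureTheory.integral_const_mul,
      MeasureTheory.integral_const_mul]
    have h0 := integral_inv_sq_add_sq (by norm_num : (0 : ℝ) < 3 / 2) 0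
    simp only [zero_sub, even_two, Even.neg_pow] at h0
    rw [h0]
    have := integral_log_div_zero_le
    nlinarith [Real.pi_pos]
  by_cases hφ : Integrable fun v : ℝ ↦ (4.62 + 1 / 2 * Real.log (1 + v ^ 2 / 9)) / (c ^ 2 + v ^ 2)
  · exact (integral_mono hφ hψ hle).trans hRHS
  · rw [integral_undef hφ]
    have h2 := Real.log_two_gt_d9
    nlinarith [Real.pi_gt_three]

end FordL45

end Literature.NumberTheory.LFunctions
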